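import Mathlib
import Summits.MatrixMultiplication.MatrixMultiplication.Theses.ThinBlockAlpha

set_option linter.dupNamespace false

/-!
# Line `three-sphere-frame-designs` — skeleton for crux `ThinBlockAlpha.ThinPackings`
(stmt-MatrixMultiplication-10595, route ThinBlockAlpha)

crux-plan (planner-cruxplan-stmt-MatrixMultiplication-10595-three-sphere-frame-d-0, 2026-08-16).
Idea card: `Cruxes/ThinPackings/Ideas/three-sphere-frame-designs.md` (ideator 3, round 1;
triage r1: pass / pass / pass).  Line card: `Lines/three-sphere-frame-designs.md`.

THE LINE.  Every block is an ORTHOGONAL THREE-SPHERE FRAME of `ℤ^D`: `A i`, `B i`, `C i` are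
finite sets of lattice points, pairwise orthogonal across the three legs of a block, lying on
three spheres `‖x‖² = rA`, `‖y‖² = rB`, `‖z‖² = rC` (the same radii for all blocks), inside the
sup-norm box `[-R, R]^D`.  Then (stub_pairCollapse, provable now) the simultaneous TPP is
implied by the three PACKINGS (tiles `C i − A i`, `B i − A i`, `B i − C i` never shared by two
blocks) plus the ALL-DISTINCT-LABEL clause — the TPP of each block and every two-label cross
clause are discharged by one Pythagoras step (positivity of `Σ v_t²` over `ℤ`).  A box family
is transported without carries into the finite host `(ℤ/(6R+1))^D` (stub_boxTransport,
provable now).  Everything else is the DESIGN (stub_frameDesign, the load-bearing open stub):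
for every shape exponent `a < 1` and slack `η > 0`, a sphere-frame system with the packings,
the distinct clause, blocks `⟨N, M, N⟩` with `N ≥ 2`, `N^a ≤ M`, and near-tight two long legs
`(6R+1)^D ≤ L · N^{2+η}`.

Registered stubs (3): `stub_frameDesign` (XL, open — hardest), `stub_pairCollapse` (M,
provable now), `stub_boxTransport` (M, provable now).  Composition `ThinPackings_of :
Stmt.stub_frameDesign → Stmt.stub_pairCollapse → Stmt.stub_boxTransport → ThinBlockAlpha.ThinPackings`
is kernel-checked (no sorry; hypotheses are the stub statements as named `Prop`s, admissible by name;
conclusion the crux decl by name) and `ThinPackings_proof : ThinPackings` applies it to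
the three registered (sorried) stubs.

Disproof.lean (cdisprove cycles 1–2, re-read 2026-08-16T02:40Z) honoured: no `_false_without_`
theorem or §4 Target exists yet; §6 (difference cores, landed p76083: no leg of a witness is a
family of translates, each leg meets `≥ M·N^{−η}` translation classes, `thin_core_B`) is met by
frames in pairwise distinct subspaces and is recorded in the line card as a DESIGN CONSTRAINT
(no common middle sphere set, no A- or C-set recycled across more than `~6^D` blocks); §7
(`thinPackings_iff_cThesis`, the costume theorem) makes SQUARE witnesses `M = N` admissible at
every `a`, and the stub keeps the permissive `N^a ≤ M` (thin or square; the symmetrised cube of a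
thin sphere-frame design is again a sphere-frame design); §8 `host_cap_of_exponent_le` is met by
`R → ∞`.  The stub set respects every landed Negative lemma of
`Theorems/ThinPackings/Negative/ThinPackingsStrengtheningsFalse.lean`:
`not_thinPackingsBoundedExponent` (host exponent `6R+1 → ∞` with `(a, 1/η)`),
`not_thinPackingsBoundedN` (`N` free to grow), `not_thinPackingsSingleBlock` (`L` free, in fact
`L ≥ 3^D · M / N^η` is forced here), `not_thinPackingsExact` (`η > 0` kept); and the packing
necessities of `ThinPackingsPacking.lean` (`M_le`, `rpow_sub_le_L`) are consistent with the
frame numerology `M = R^{(1−2δ)D} < N = R^{δD}`, `δ = 1/(2+a) ∈ (1/3, 1/2]`.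
-/

namespace Summit.MatrixMultiplication.MatrixMultiplication.Cruxes.ThinPackings.ThreeSphereFrameDesigns

open Finset

/-! ## Statements of the three stubs as named `Prop`s (`Stmt.stub_*`)

Single source for the composition `ThinPackings_of`, whose hypotheses must be the declared stubs BY NAME for
the skeleton audit (a hypothesis is admissible iff its head constant's last name component is a registered
stub name — hence the `Stmt` sub-namespace with the same short names); the REGISTERED stubs `stub_*` below
restate them verbatim as sorried theorems, and `ThinPackings_proof` type-checks only if the two copies agree
definitionally.  (The gate-reserved `stub` attribute is deliberately not applied in this seat file.) -/
namespace Stmt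

/-- Statement of `stub_frameDesign` (the three-sphere frame design; hardest). -/
def stub_frameDesign : Prop :=
    ∀ a : ℝ, 0 ≤ a → a < 1 → ∀ η : ℝ, 0 < η →
      ∃ (D R L N M : ℕ) (rA rB rC : ℤ) (A B C : Fin L → Finset (Fin D → ℤ)),
        (∀ i, ∀ x ∈ A i, ∀ t, |x t| ≤ (R : ℤ)) ∧ (∀ i, ∀ y ∈ B i, ∀ t, |y t| ≤ (R : ℤ)) ∧
        (∀ i, ∀ z ∈ C i, ∀ t, |z t| ≤ (R : ℤ)) ∧
        (∀ i, ∀ x ∈ A i, x ⬝ᵥ x = rA) ∧ (∀ i, ∀ y ∈ B i, y ⬝ᵥ y = rB) ∧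
        (∀ i, ∀ z ∈ C i, z ⬝ᵥ z = rC) ∧
        (∀ i, ∀ x ∈ A i, ∀ y ∈ B i, x ⬝ᵥ y = 0) ∧ (∀ i, ∀ x ∈ A i, ∀ z ∈ C i, x ⬝ᵥ z = 0) ∧
        (∀ i, ∀ y ∈ B i, ∀ z ∈ C i, y ⬝ᵥ z = 0) ∧
        (∀ i k, ∀ x ∈ A i, ∀ z ∈ C i, ∀ x' ∈ A k, ∀ z' ∈ C k, z - x = z' - x' → i = k) ∧
        (∀ i k, ∀ x ∈ A i, ∀ y ∈ B i, ∀ x' ∈ A k, ∀ y' ∈ B k, y - x = y' - x' → i = k) ∧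
        (∀ i k, ∀ y ∈ B i, ∀ z ∈ C i, ∀ y' ∈ B k, ∀ z' ∈ C k, y - z = y' - z' → i = k) ∧
        (∀ i j k : Fin L, i ≠ j → j ≠ k → i ≠ k →
          ∀ s ∈ A k, ∀ s' ∈ A i, ∀ t ∈ B i, ∀ t' ∈ B j, ∀ u ∈ C j, ∀ u' ∈ C k,
            (s' - s) + (t' - t) + (u' - u) ≠ 0) ∧
        (∀ i, (A i).card = N ∧ (B i).card = M ∧ (C i).card = N) ∧ 2 ≤ N ∧
        (N : ℝ) ^ a ≤ M ∧ (((6 * R + 1) ^ D : ℕ) : ℝ) ≤ L * (N : ℝ) ^ (2 + η)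

/-- Statement of `stub_pairCollapse` (three-sphere pair collapse, `←` direction). -/
def stub_pairCollapse : Prop :=
    ∀ (D L : ℕ) (A B C : Fin L → Finset (Fin D → ℤ)) (rA rB rC : ℤ),
      (∀ i, ∀ x ∈ A i, x ⬝ᵥ x = rA) → (∀ i, ∀ y ∈ B i, y ⬝ᵥ y = rB) →
      (∀ i, ∀ z ∈ C i, z ⬝ᵥ z = rC) →
      (∀ i, ∀ x ∈ A i, ∀ y ∈ B i, x ⬝ᵥ y = 0) → (∀ i, ∀ x ∈ A i, ∀ z ∈ C i, x ⬝ᵥ z = 0) →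
      (∀ i, ∀ y ∈ B i, ∀ z ∈ C i, y ⬝ᵥ z = 0) →
      (∀ i k, ∀ x ∈ A i, ∀ z ∈ C i, ∀ x' ∈ A k, ∀ z' ∈ C k, z - x = z' - x' → i = k) →
      (∀ i k, ∀ x ∈ A i, ∀ y ∈ B i, ∀ x' ∈ A k, ∀ y' ∈ B k, y - x = y' - x' → i = k) →
      (∀ i k, ∀ y ∈ B i, ∀ z ∈ C i, ∀ y' ∈ B k, ∀ z' ∈ C k, y - z = y' - z' → i = k) →
      (∀ i j k : Fin L, i ≠ j → j ≠ k → i ≠ k →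
        ∀ s ∈ A k, ∀ s' ∈ A i, ∀ t ∈ B i, ∀ t' ∈ B j, ∀ u ∈ C j, ∀ u' ∈ C k,
          (s' - s) + (t' - t) + (u' - u) ≠ 0) →
      Literature.Computability.AlgebraicComplexity.IsSTPP A B C

/-- Statement of `stub_boxTransport` (carry-free box transport into `(ZMod m)^D`, `m > 6R`). -/
def stub_boxTransport : Prop :=
    ∀ (D R m L : ℕ) (A B C : Fin L → Finset (Fin D → ℤ)), 6 * R < m →
      (∀ i, ∀ x ∈ A i, ∀ t, |x t| ≤ (R : ℤ)) → (∀ i, ∀ y ∈ B i, ∀ t, |y t| ≤ (R : ℤ)) →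
      (∀ i, ∀ z ∈ C i, ∀ t, |z t| ≤ (R : ℤ)) →
      Literature.Computability.AlgebraicComplexity.IsSTPP A B C →
      Literature.Computability.AlgebraicComplexity.IsSTPP
          (fun i => (A i).image fun (x : Fin D → ℤ) (t : Fin D) => ((x t : ℤ) : ZMod m))
          (fun i => (B i).image fun (x : Fin D → ℤ) (t : Fin D) => ((x t : ℤ) : ZMod m))
          (fun i => (C i).image fun (x : Fin D → ℤ) (t : Fin D) => ((x t : ℤ) : ZMod m)) ∧
        ∀ i, ((A i).image fun (x : Fin D → ℤ) (t : Fin D) => ((x t : ℤ) : ZMod m)).card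
              = (A i).card ∧
            ((B i).image fun (x : Fin D → ℤ) (t : Fin D) => ((x t : ℤ) : ZMod m)).card
              = (B i).card ∧
            ((C i).image fun (x : Fin D → ℤ) (t : Fin D) => ((x t : ℤ) : ZMod m)).card
              = (C i).card

end Stmt

/-! ## Stub 1 (hardest, XL/open): the three-sphere frame DESIGN with packings + distinct clause

For every `a ∈ [0,1)` and `η > 0`: a dimension `D`, a box radius `R`, radii `rA rB rC`, and
`L` blocks `(A i, B i, C i)` of lattice points of `ℤ^D` with sup-norm `≤ R` such that
* spheres: `x ⬝ᵥ x = rA` on `A i`, `= rB` on `B i`, `= rC` on `C i` (same radii for all `i`);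
* frames: the three legs of a block are pairwise orthogonal (pointwise `x ⬝ᵥ y = 0`);
* packings PD / PE / PF: a difference `z − x` (`x ∈ A i`, `z ∈ C i`), `y − x` (`x ∈ A i`,
  `y ∈ B i`), `y − z` (`y ∈ B i`, `z ∈ C i`) determines its block;
* the all-distinct-label STPP clause (labels `i, j, k` pairwise distinct);
* shape `⟨N, M, N⟩` with `2 ≤ N`, `N^a ≤ M`, and two-leg near-tightness against the host
  `(ℤ/(6R+1))^D`: `(6R+1)^D ≤ L · N^{2+η}`.
Why it might fail: generic dense rational frames collide (tile-sum intersections have dimension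
`≥ (4δ−1)D > 0` in the volume-tight regime, and general position is unaffordable at
`L = R^{Θ(D)}` blocks — line card §Numbers), so PD/PE/PF and above all the distinct clause need
ARITHMETIC structure of the frames; no candidate family is known (triage r1-2 doubt 1, r1-3
doubt 1).  Sources: Beker arXiv:2402.19169 §2; Pratt arXiv:2309.03878 Conj 4.1 / Thm 4.4;
CKSU arXiv:math/0511460 Thm 33; BCCGNSU arXiv:1605.06702 Thm B; card + Ideator3NegativeNotes
B1–B8. -/
theorem stub_frameDesign :
    ∀ a : ℝ, 0 ≤ a → a < 1 → ∀ η : ℝ, 0 < η →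
      ∃ (D R L N M : ℕ) (rA rB rC : ℤ) (A B C : Fin L → Finset (Fin D → ℤ)),
        (∀ i, ∀ x ∈ A i, ∀ t, |x t| ≤ (R : ℤ)) ∧ (∀ i, ∀ y ∈ B i, ∀ t, |y t| ≤ (R : ℤ)) ∧
        (∀ i, ∀ z ∈ C i, ∀ t, |z t| ≤ (R : ℤ)) ∧
        (∀ i, ∀ x ∈ A i, x ⬝ᵥ x = rA) ∧ (∀ i, ∀ y ∈ B i, y ⬝ᵥ y = rB) ∧
        (∀ i, ∀ z ∈ C i, z ⬝ᵥ z = rC) ∧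
        (∀ i, ∀ x ∈ A i, ∀ y ∈ B i, x ⬝ᵥ y = 0) ∧ (∀ i, ∀ x ∈ A i, ∀ z ∈ C i, x ⬝ᵥ z = 0) ∧
        (∀ i, ∀ y ∈ B i, ∀ z ∈ C i, y ⬝ᵥ z = 0) ∧
        (∀ i k, ∀ x ∈ A i, ∀ z ∈ C i, ∀ x' ∈ A k, ∀ z' ∈ C k, z - x = z' - x' → i = k) ∧
        (∀ i k, ∀ x ∈ A i, ∀ y ∈ B i, ∀ x' ∈ A k, ∀ y' ∈ B k, y - x = y' - x' → i = k) ∧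
        (∀ i k, ∀ y ∈ B i, ∀ z ∈ C i, ∀ y' ∈ B k, ∀ z' ∈ C k, y - z = y' - z' → i = k) ∧
        (∀ i j k : Fin L, i ≠ j → j ≠ k → i ≠ k →
          ∀ s ∈ A k, ∀ s' ∈ A i, ∀ t ∈ B i, ∀ t' ∈ B j, ∀ u ∈ C j, ∀ u' ∈ C k,
            (s' - s) + (t' - t) + (u' - u) ≠ 0) ∧
        (∀ i, (A i).card = N ∧ (B i).card = M ∧ (C i).card = N) ∧ 2 ≤ N ∧
        (N : ℝ) ^ a ≤ M ∧ (((6 * R + 1) ^ D : ℕ) : ℝ) ≤ L * (N : ℝ) ^ (2 + η) := by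
  sorry

/-! ## Stub 2 (M, provable now): THREE-SPHERE PAIR COLLAPSE (the `←` direction the line uses)

For sphere-frame families in `ℤ^D` the three packings plus the all-distinct-label clause imply
`IsSTPP`.  Proof sketch (line card; Ideator3Sketch `ThreeSpherePairCollapse`, re-derived by all
three triagers): case split on the label pattern.  `i = j = k`: the three block-differences
`α = s'−s`, `β = t'−t`, `γ = u'−u` are pairwise orthogonal and sum to `0`, so
`α ⬝ᵥ α = 0`, hence `α = 0` (`dotProduct_self_eq_zero` over `ℤ`), etc.  `i = j ≠ k`:
`u'−s = (u−s') + (t−t')` with `‖u'−s‖² = rA + rC = ‖u−s'‖²` and `(u−s') ⊥ (t−t')`, so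
`‖t−t'‖² = 0`, `t = t'`, and then `u − s' = u' − s` is a PD-collision forcing `i = k`.  The
patterns `j = k ≠ i` (PE, radii `rA + rB`) and `i = k ≠ j` (PF, radii `rB + rC`) are symmetric;
all-distinct is the hypothesis.  No nonemptiness and no positivity of the radii are needed in
this direction (triage r1-1's counterexample concerns `→` only).  ~150 lines.
[folklore Pythagoras; Beker arXiv:2402.19169 §2 for the planar shadow] -/
theorem stub_pairCollapse :
    ∀ (D L : ℕ) (A B C : Fin L → Finset (Fin D → ℤ)) (rA rB rC : ℤ),
      (∀ i, ∀ x ∈ A i, x ⬝ᵥ x = rA) → (∀ i, ∀ y ∈ B i, y ⬝ᵥ y = rB) →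
      (∀ i, ∀ z ∈ C i, z ⬝ᵥ z = rC) →
      (∀ i, ∀ x ∈ A i, ∀ y ∈ B i, x ⬝ᵥ y = 0) → (∀ i, ∀ x ∈ A i, ∀ z ∈ C i, x ⬝ᵥ z = 0) →
      (∀ i, ∀ y ∈ B i, ∀ z ∈ C i, y ⬝ᵥ z = 0) →
      (∀ i k, ∀ x ∈ A i, ∀ z ∈ C i, ∀ x' ∈ A k, ∀ z' ∈ C k, z - x = z' - x' → i = k) →
      (∀ i k, ∀ x ∈ A i, ∀ y ∈ B i, ∀ x' ∈ A k, ∀ y' ∈ B k, y - x = y' - x' → i = k) →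
      (∀ i k, ∀ y ∈ B i, ∀ z ∈ C i, ∀ y' ∈ B k, ∀ z' ∈ C k, y - z = y' - z' → i = k) →
      (∀ i j k : Fin L, i ≠ j → j ≠ k → i ≠ k →
        ∀ s ∈ A k, ∀ s' ∈ A i, ∀ t ∈ B i, ∀ t' ∈ B j, ∀ u ∈ C j, ∀ u' ∈ C k,
          (s' - s) + (t' - t) + (u' - u) ≠ 0) →
      Literature.Computability.AlgebraicComplexity.IsSTPP A B C := by
  sorry

/-! ## Stub 3 (M, provable now): BOX TRANSPORT without carries

An `IsSTPP` family of `ℤ^D` inside the sup-norm box `[-R, R]^D` stays `IsSTPP`, with the same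
cardinalities, under coordinatewise reduction modulo any `m > 6R`: each coordinate of a
relation `(s'−s)+(t'−t)+(u'−u)` lies in `[-6R, 6R]`, so it vanishes mod `m` iff it vanishes,
and the reduction is injective on the box.  (A localized form of the tree's Freiman transport
`addSimultaneousTPP_image_of_reflect`, whose reflection hypothesis is global and so does not
apply verbatim; bridge `isSTPP_iff_addSimultaneousTPP`.)  ~100 lines.
[folklore; Pratt arXiv:2309.03878 Thm 4.4/4.7 (proof) for the mixed-radix analogue] -/
theorem stub_boxTransport :
    ∀ (D R m L : ℕ) (A B C : Fin L → Finset (Fin D → ℤ)), 6 * R < m →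
      (∀ i, ∀ x ∈ A i, ∀ t, |x t| ≤ (R : ℤ)) → (∀ i, ∀ y ∈ B i, ∀ t, |y t| ≤ (R : ℤ)) →
      (∀ i, ∀ z ∈ C i, ∀ t, |z t| ≤ (R : ℤ)) →
      Literature.Computability.AlgebraicComplexity.IsSTPP A B C →
      Literature.Computability.AlgebraicComplexity.IsSTPP
          (fun i => (A i).image fun (x : Fin D → ℤ) (t : Fin D) => ((x t : ℤ) : ZMod m))
          (fun i => (B i).image fun (x : Fin D → ℤ) (t : Fin D) => ((x t : ℤ) : ZMod m))
          (fun i => (C i).image fun (x : Fin D → ℤ) (t : Fin D) => ((x t : ℤ) : ZMod m)) ∧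
        ∀ i, ((A i).image fun (x : Fin D → ℤ) (t : Fin D) => ((x t : ℤ) : ZMod m)).card
              = (A i).card ∧
            ((B i).image fun (x : Fin D → ℤ) (t : Fin D) => ((x t : ℤ) : ZMod m)).card
              = (B i).card ∧
            ((C i).image fun (x : Fin D → ℤ) (t : Fin D) => ((x t : ℤ) : ZMod m)).card
              = (C i).card := by
  sorry

/-! ## Composition (kernel-checked, no sorry): the three stubs give the crux by name -/

theorem ThinPackings_of :
    Stmt.stub_frameDesign → Stmt.stub_pairCollapse → Stmt.stub_boxTransport →
    Summit.MatrixMultiplication.MatrixMultiplication.Theses.ThinBlockAlpha.ThinPackings := by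
  intro hDesign hCollapse hTransport a ha0 ha1 η hη
  obtain ⟨D, R, L, N, M, rA, rB, rC, A, B, C, hbA, hbB, hbC, hsA, hsB, hsC, hoAB, hoAC, hoBC,
    hPD, hPE, hPF, hDist, hcard, hN, hM, hH⟩ := hDesign a ha0 ha1 η hη
  have hS : Literature.Computability.AlgebraicComplexity.IsSTPP A B C :=
    hCollapse D L A B C rA rB rC hsA hsB hsC hoAB hoAC hoBC hPD hPE hPF hDist
  obtain ⟨hS', hc'⟩ := hTransport D R (6 * R + 1) L A B C (by omega) hbA hbB hbC hS
  refine ⟨Fin D → ZMod (6 * R + 1), inferInstance, inferInstance, L, N, M, _, _, _, hS', ?_,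
    hN, hM, ?_⟩
  · intro i
    obtain ⟨h1, h2, h3⟩ := hc' i
    obtain ⟨g1, g2, g3⟩ := hcard i
    exact ⟨h1.trans g1, h2.trans g2, h3.trans g3⟩
  · have hcardH : Fintype.card (Fin D → ZMod (6 * R + 1)) = (6 * R + 1) ^ D := by
      rw [Fintype.card_fun, ZMod.card, Fintype.card_fin]
    calc (Fintype.card (Fin D → ZMod (6 * R + 1)) : ℝ) = (((6 * R + 1) ^ D : ℕ) : ℝ) := by
          rw [hcardH]
      _ ≤ L * (N : ℝ) ^ (2 + η) := hH

/-- The skeleton closes the crux modulo the registered stubs (sorries live only in `stub_*`). -/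
theorem ThinPackings_proof :
    Summit.MatrixMultiplication.MatrixMultiplication.Theses.ThinBlockAlpha.ThinPackings :=
  ThinPackings_of stub_frameDesign stub_pairCollapse stub_boxTransport

end Summit.MatrixMultiplication.MatrixMultiplication.Cruxes.ThinPackings.ThreeSphereFrameDesigns
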